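import Literature.NumberTheory.Automorphic.Liu2021.AppendixC.EtaleHeckeDatumOfTranslates
import Literature.NumberTheory.Automorphic.Liu2021.AppendixC.H1ComparisonFamilyHolds
import Literature.NumberTheory.Automorphic.Liu2021.AppendixC.EtaleFaltingsTower
import HarnessLib

/-!
# [Liu 2021, §4.3 l. 2154–2160] the named fact «`StubEtaleModel`» = `Sec42Data.exists_etaleHeckeDatum_with_bettiComparison`
# HOLDS for every tower whose Hecke translates satisfy descent up to isogeny (row (D)) — row VI-2″ of the cell hodgecm-mathlib

Topic `NumberTheory/Automorphic/Liu2021/AppendixC`; namespace `Literature.NumberTheory.Automorphic.Liu2021.AppendixC`.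
Continuation of `EtaleBettiComparison.lean` (p595473: the named fact, debt +1, «binder-conditional»), of
`H1ComparisonFamilyHolds.lean` (p598493: the comparison family `h1ComparisonFamilyAlong τ' ℓ ι`, i.e. [SGA4 XI 4.4] in degree one for
abelian varieties, PROVED) and of `EtaleHeckeDatumOfTranslates.lean` (the étale Hecke datum `T.etaleHeckeDatumOfTranslates` CONSTRUCTED
from the translates, level-compatible from `T.IsogenyDescent`).

THE POINT.  The fact's module docstring books `∃ X` as asserting, beyond the comparison theorem, smoothness and LEVEL COMPATIBILITY of
the induced action, «rows (I) `AlbTransitionEpi`, (D) `HonestIsogenyDescent` of a3-liu418», and declines the universal closure over all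
posited `(C, T)`.  Here we prove the closure over ALL `(C, T, τ', ι, H, rhoB, B)` GRANTED `T.IsogenyDescent` ALONE:
* the Betti pinning `B` by itself forces injectivity of every pull-back `Alb_u^*` on the real Betti levels (`b_K` injective, `b_{K'} ∘
  Alb_u^* = b_K`), hence — through the natural bijective comparison family — of every étale pull-back `ᵗV_ℓ(Alb_u)`
  (`BettiPinning.dualMap_rationalTateModuleMap_Atr_injective`; so row (I) is NOT needed on the étale side);
* `range [·]_K = H¹_ét(A_∞)^K` comes from (D) by the norm-endomorphism argument of `EtaleHeckeDatumOfTranslates.lean`;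
* the comparison `cmp : H →ₛₗ[ι] ℚ_ℓ^{ac} ⊗ H¹_ét(A_∞)` is DEFINED on level classes by `cmp (b_K y) := ([·]_K ⊗ 1) (c_{A_K} y)`
  (`BettiPinning.cmpAlong`; well defined by common refinements, `b_one`, `b_injective`, naturality of `c` and `toTower_pull`), is additive and
  `ι`-semilinear, bijective (`exhaust`; `[·]_K ⊗ 1` injective; `c_{A_K}` bijective; every class of the tower is a level class) and
  Hecke-equivariant (`b_hecke`, naturality of `c`, `IsInducedBy`).

Main results: **`Sec42Data.exists_etaleHeckeDatum_with_bettiComparison_of_isogenyDescent (hD : T.IsogenyDescent) (τ') (ι) (H) (rhoB) (B) :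
C.exists_etaleHeckeDatum_with_bettiComparison ℓ T τ' ι H rhoB B`** (§4), and its specialisation-free corollaries.  Consumer: the a3_liu418
v4 stub `stub_etaleComparisonAtFace : EtaleComparisonAtFace` (:569), closed BY NAME in `Summits/…/A3Liu418EtaleComparisonAtFace.lean` from
this theorem and A-p12's `stubHonestIsogenyDescent_holds` (row (D) at the pin).  Definitions with bodies (`cmpLevel`, `cmpAlong`) and
theorems only: NO named fact, NO instance, NO `sorry`; net Literature debt −1 at the pin (the fact's `_holds` under (D)).  HC_CM is proved
only modulo the 7 printed citations until rung 0 closes; this file discharges none of them by itself.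

## References
* [Liu2021] Y. Liu, *Fourier–Jacobi cycles and arithmetic relative trace formula*, Camb. J. Math. 9 (2021) = arXiv:2102.11518
  (`FJcycle.tex`): §4.2 l. 2074, 2079–2081; §4.3 l. 2154–2160; Thm. 4.18 (1) l. 2239 and proof l. 2254–2262, 2274–2282; Lem. 2.4 (1).
* [SGA4Tome3] M. Artin, A. Grothendieck, J.-L. Verdier, SGA 4 Tome 3, Exp. XI Thm. 4.4 (comparison étale/Betti).
* [Lang1982AbelianFunctions] S. Lang, *Introduction to Algebraic and Abelian Functions*, 2nd ed., Ch. VII §2 p. 115 (`T_ℓ = H_1 ⊗ ℤ_ℓ`).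
* [Milne1986AbelianVarieties] J. S. Milne, *Abelian varieties* (Cornell–Silverman 1986), Thm 15.1 (a).
* Tree: `AppendixC.EtaleBettiComparison` (the fact, `BettiPinning`, `H1ComparisonFamily`), `AppendixC.H1ComparisonFamilyHolds`
  (`h1ComparisonFamilyAlong`), `AppendixC.EtaleHeckeDatumOfTranslates` (`etaleHeckeDatumOfTranslates`, `toTower_injective`),
  `AppendixC.EtaleFaltingsTower` (`toTower_baseChange_injective`, `exists_eq_toTower_baseChange`, `toTower_baseChange_comp_h1PullBar`,
  `rhoEt_baseChange_comp_toTower`), `AppendixC.EtaleH1Pullback` (`h1PullBar`).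
-/

set_option autoImplicit false

noncomputable section

open CategoryTheory NumberField Function
open scoped TensorProduct

namespace Literature.NumberTheory.Automorphic.Liu2021.AppendixC

open Literature.AlgebraicGeometry.Motives (AbelianVariety)
open Literature.AlgebraicGeometry.Motives.AbelianVariety (rationalTateModuleMap)

/-! ## §1 Injectivity descends along `ℚ_ℓ → ℚ_ℓ^{ac}` (bookkeeping) -/

namespace H1Comparison

variable (ℓ : ℕ) [Fact ℓ.Prime]

/-- `m ↦ 1 ⊗ m : M → ℚ_ℓ^{ac} ⊗_{ℚ_ℓ} M` is injective (a field extension is faithfully flat; Mathlib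
`Module.Flat.rTensor_preserves_injective_linearMap` + `TensorProduct.lid`). [cite: Lang1982AbelianFunctions, Ch. VII §2, p. 115] -/
theorem one_tmul_injective (M : Type*) [AddCommGroup M] [Module ℚ_[ℓ] M] :
    Injective fun m : M => (1 : AlgebraicClosure ℚ_[ℓ]) ⊗ₜ[ℚ_[ℓ]] m := by
  have hf := Module.Flat.rTensor_preserves_injective_linearMap (M := M) (Algebra.linearMap ℚ_[ℓ] (AlgebraicClosure ℚ_[ℓ]))
    (algebraMap ℚ_[ℓ] (AlgebraicClosure ℚ_[ℓ])).injective
  intro v w hvw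
  have : (Algebra.linearMap ℚ_[ℓ] (AlgebraicClosure ℚ_[ℓ])).rTensor M ((TensorProduct.lid ℚ_[ℓ] M).symm v) =
      (Algebra.linearMap ℚ_[ℓ] (AlgebraicClosure ℚ_[ℓ])).rTensor M ((TensorProduct.lid ℚ_[ℓ] M).symm w) := by
    simpa using hvw
  exact (TensorProduct.lid ℚ_[ℓ] M).symm.injective (hf this)

/-- A `ℚ_ℓ`-linear map whose base change to `ℚ_ℓ^{ac}` is injective is injective (`(1 ⊗ f) (1 ⊗ m) = 1 ⊗ f m`).
[cite: Lang1982AbelianFunctions, Ch. VII §2, p. 115] -/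
theorem injective_of_baseChange_injective {M N : Type*} [AddCommGroup M] [Module ℚ_[ℓ] M] [AddCommGroup N] [Module ℚ_[ℓ] N]
    (f : M →ₗ[ℚ_[ℓ]] N) (h : Injective (f.baseChange (AlgebraicClosure ℚ_[ℓ]))) : Injective f := by
  intro m m' hmm'
  apply one_tmul_injective ℓ M
  apply h
  show f.baseChange (AlgebraicClosure ℚ_[ℓ]) ((1 : AlgebraicClosure ℚ_[ℓ]) ⊗ₜ[ℚ_[ℓ]] m) =
    f.baseChange (AlgebraicClosure ℚ_[ℓ]) ((1 : AlgebraicClosure ℚ_[ℓ]) ⊗ₜ[ℚ_[ℓ]] m')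
  rw [LinearMap.baseChange_tmul, LinearMap.baseChange_tmul, hmm']

end H1Comparison

variable {F E : Type} [Field F] [NumberField F] [IsTotallyReal F] [Field E] [NumberField E] [Algebra F E]
  [IsTotallyComplex E] [Algebra.IsQuadraticExtension F E]
variable {P5 : PropC5Data F E} {isotropicAt : ℕ → Prop}

/-! ## §2 What the Betti pinning forces: injective pull-backs on the real levels, hence on `H¹_ét` -/

namespace Sec42Data.BettiPinning

variable {C : Sec42Data P5 isotropicAt} {T : C.HeckeTranslates} {τ' : E →+* ℂ} {H : Type} [AddCommGroup H] [Module ℂ H]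
  {rhoB : Representation ℂ C.G H} (B : C.BettiPinning T τ' H rhoB)

/-- Transition compatibility with `Alb_u` itself: `b_{K'} (Alb_u^* y) = b_K y` for `K' ⊆ K` (`b_one` with `Alb(T_1) = Alb_u`).
[cite: Liu2021, §4.2 (FJcycle.tex l. 2070–2079)] -/
theorem b_bettiPullAlong_Atr {K K' : C5.SmallLevel C.S.K₀} (f : K' ⟶ K) (y : C.bettiH1 τ' K) :
    B.b K' (bettiPullAlong τ' (C.Atr f) y) = B.b K y := by
  rw [← T.albTr_one f]
  exact (B.b_one K' K _ y).symm

/-- **The pinning forces `Alb_u^*` to be injective on the real Betti levels** (`b_K` injective and `b_{K'} ∘ Alb_u^* = b_K`).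
[cite: Liu2021, §4.2 (FJcycle.tex l. 2079–2081)] -/
theorem bettiPullAlong_Atr_injective (B : C.BettiPinning T τ' H rhoB) {K K' : C5.SmallLevel C.S.K₀} (f : K' ⟶ K) :
    Injective (bettiPullAlong τ' (C.Atr f) : C.bettiH1 τ' K → C.bettiH1 τ' K') := by
  intro y y' h
  apply B.b_injective K
  rw [← B.b_bettiPullAlong_Atr f y, ← B.b_bettiPullAlong_Atr f y', h]

/-- **Hence every étale pull-back `ᵗV_ℓ(Alb_u) : H¹_ét(A_K) → H¹_ét(A_{K'})` is injective**, for ANY natural bijective comparison family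
`c` (transport through `c_{A_K}`, `c_{A_{K'}}` and descent of injectivity from `ℚ_ℓ^{ac}`) — the étale analogue of row (I), obtained from
the pinning instead. [cite: Liu2021, §4.3 (FJcycle.tex l. 2154–2158)] [cite: SGA4Tome3, Exp. XI Thm. 4.4] -/
theorem dualMap_rationalTateModuleMap_Atr_injective (B : C.BettiPinning T τ' H rhoB) (ℓ : ℕ) [Fact ℓ.Prime] {ι : ℂ ≃+* AlgebraicClosure ℚ_[ℓ]}
    (c : H1ComparisonFamily (E := E) τ' ℓ ι) {K K' : C5.SmallLevel C.S.K₀} (f : K' ⟶ K) :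
    Injective (rationalTateModuleMap ℓ (C.Atr f)).dualMap := by
  apply H1Comparison.injective_of_baseChange_injective ℓ
  intro u u' huu'
  obtain ⟨y, rfl⟩ := (c.bijective (C.A K)).2 u
  obtain ⟨y', rfl⟩ := (c.bijective (C.A K)).2 u'
  have key : c.cmp (C.A K') (bettiPullAlong τ' (C.Atr f) y) = c.cmp (C.A K') (bettiPullAlong τ' (C.Atr f) y') := by
    rw [c.natural, c.natural]
    exact huu'
  rw [B.bettiPullAlong_Atr_injective f ((c.bijective (C.A K')).1 key)]

/-! ## §3 The comparison in the colimit, defined on level classes -/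

variable (ℓ : ℕ) [Fact ℓ.Prime] (ι : ℂ ≃+* AlgebraicClosure ℚ_[ℓ]) (c : H1ComparisonFamily (E := E) τ' ℓ ι)

/-- The level-`K` comparison into the colimit: `y ↦ ([·]_K ⊗ 1) (c_{A_K} y)`, `ι`-semilinear. [cite: Liu2021, §4.3 (FJcycle.tex l. 2154–2158)] -/
def cmpLevel (K : C5.SmallLevel C.S.K₀) :
    C.bettiH1 τ' K →ₛₗ[(ι : ℂ →+* AlgebraicClosure ℚ_[ℓ])] AlgebraicClosure ℚ_[ℓ] ⊗[ℚ_[ℓ]] C.etaleH1Tower ℓ :=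
  ((C.toTower ℓ K).baseChange (AlgebraicClosure ℚ_[ℓ])).comp (c.cmp (C.A K))

/-- Unfolding of `cmpLevel`. [cite: Liu2021, §4.3 (FJcycle.tex l. 2154–2158)] -/
theorem cmpLevel_apply (K : C5.SmallLevel C.S.K₀) (y : C.bettiH1 τ' K) :
    cmpLevel (C := C) ℓ ι c K y = (C.toTower ℓ K).baseChange (AlgebraicClosure ℚ_[ℓ]) (c.cmp (C.A K) y) :=
  rfl

/-- The level comparisons are compatible with `Alb_u^*` (naturality of `c` and `[·]_{K'} ∘ ᵗV_ℓ(Alb_u) = [·]_K`).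
[cite: Liu2021, §4.3 (FJcycle.tex l. 2154–2158)] -/
theorem cmpLevel_bettiPullAlong_Atr {K K' : C5.SmallLevel C.S.K₀} (f : K' ⟶ K) (y : C.bettiH1 τ' K) :
    cmpLevel (C := C) ℓ ι c K' (bettiPullAlong τ' (C.Atr f) y) = cmpLevel (C := C) ℓ ι c K y := by
  rw [cmpLevel_apply, cmpLevel_apply, c.natural]
  exact LinearMap.congr_fun (toTower_baseChange_comp_h1PullBar C ℓ f) (c.cmp (C.A K) y)

/-- **Well-definedness on `H`**: if `b_K y = b_{K'} y'` then the level comparisons agree (pass to a common refinement, where the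
pulled-back classes coincide by `b_injective`). [cite: Liu2021, §4.2 l. 2079 and §4.3 l. 2154–2158] -/
theorem cmpLevel_eq_of_b_eq {K K' : C5.SmallLevel C.S.K₀} {y : C.bettiH1 τ' K} {y' : C.bettiH1 τ' K'}
    (h : B.b K y = B.b K' y') : cmpLevel (C := C) ℓ ι c K y = cmpLevel (C := C) ℓ ι c K' y' := by
  obtain ⟨M, hMK, hMK'⟩ := C5.SmallLevel.exists_le_le K K'
  have hy : bettiPullAlong τ' (C.Atr (homOfLE hMK)) y = bettiPullAlong τ' (C.Atr (homOfLE hMK')) y' := by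
    apply B.b_injective M
    rw [B.b_bettiPullAlong_Atr, B.b_bettiPullAlong_Atr, h]
  rw [← cmpLevel_bettiPullAlong_Atr ℓ ι c (homOfLE hMK) y, hy, cmpLevel_bettiPullAlong_Atr]

/-- The comparison as a bare function on `H`: the level comparison of SOME level representative (`exhaust` + choice).
[cite: Liu2021, §4.3 (FJcycle.tex l. 2154–2158)] -/
def cmpFun (x : H) : AlgebraicClosure ℚ_[ℓ] ⊗[ℚ_[ℓ]] C.etaleH1Tower ℓ :=
  cmpLevel (C := C) ℓ ι c (B.exhaust x).choose (B.exhaust x).choose_spec.choose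

/-- `cmpFun (b_K y) = ([·]_K ⊗ 1) (c_{A_K} y)` for EVERY level representative (well-definedness).
[cite: Liu2021, §4.3 (FJcycle.tex l. 2154–2158)] -/
theorem cmpFun_b (K : C5.SmallLevel C.S.K₀) (y : C.bettiH1 τ' K) :
    B.cmpFun ℓ ι c (B.b K y) = cmpLevel (C := C) ℓ ι c K y :=
  B.cmpLevel_eq_of_b_eq ℓ ι c (B.exhaust (B.b K y)).choose_spec.choose_spec

/-- **The comparison `H¹_{B,τ'}(A_∞, ℂ) ⊗_{ℂ,ι} ℚ_ℓ^{ac} → ℚ_ℓ^{ac} ⊗ H¹_ét(A_∞)`** («we have a canonical isomorphism … by the comparison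
theorem», l. 2154, passed to `colim_K`): the `ι`-SEMILINEAR map on the pinned Betti tower `H` with `cmp (b_K y) = ([·]_K ⊗ 1)(c_{A_K} y)`;
additive and semilinear because any two classes have a common level. [cite: Liu2021, §4.3 (FJcycle.tex l. 2154–2160)] [cite: SGA4Tome3, Exp. XI Thm. 4.4] -/
def cmpAlong : H →ₛₗ[(ι : ℂ →+* AlgebraicClosure ℚ_[ℓ])] AlgebraicClosure ℚ_[ℓ] ⊗[ℚ_[ℓ]] C.etaleH1Tower ℓ where
  toFun := B.cmpFun ℓ ι c
  map_add' x x' := by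
    obtain ⟨K, y, rfl⟩ := B.exhaust x
    obtain ⟨K', y', rfl⟩ := B.exhaust x'
    obtain ⟨M, hMK, hMK'⟩ := C5.SmallLevel.exists_le_le K K'
    rw [← B.b_bettiPullAlong_Atr (homOfLE hMK) y, ← B.b_bettiPullAlong_Atr (homOfLE hMK') y', ← map_add,
      B.cmpFun_b, B.cmpFun_b, B.cmpFun_b, map_add]
  map_smul' z x := by
    obtain ⟨K, y, rfl⟩ := B.exhaust x
    rw [← map_smul, B.cmpFun_b, B.cmpFun_b, LinearMap.map_smulₛₗ]

/-- **`cmp (b_K y) = ([·]_K ⊗ 1) (c_{A_K} y)`** — the comparison IS `c` level by level (the last clause of the named fact).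
[cite: Liu2021, §4.3 (FJcycle.tex l. 2154–2158)] -/
theorem cmpAlong_b (K : C5.SmallLevel C.S.K₀) (y : C.bettiH1 τ' K) :
    B.cmpAlong ℓ ι c (B.b K y) = (C.toTower ℓ K).baseChange (AlgebraicClosure ℚ_[ℓ]) (c.cmp (C.A K) y) :=
  B.cmpFun_b ℓ ι c K y

/-- The comparison is injective (a class `b_K y` with `([·]_K ⊗ 1)(c y) = 0` has `c y = 0` — `[·]_K` is injective by §2 and
`EtaleHeckeDatumOfTranslates.toTower_injective`, `ℚ_ℓ^{ac}` is flat — hence `y = 0`). [cite: Liu2021, §4.3 (FJcycle.tex l. 2154–2158)] -/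
theorem cmpAlong_injective : Injective (B.cmpAlong ℓ ι c) := by
  refine (injective_iff_map_eq_zero (B.cmpAlong ℓ ι c)).2 fun x hx => ?_
  obtain ⟨K, y, rfl⟩ := B.exhaust x
  rw [cmpAlong_b] at hx
  have hI : ∀ ⦃K K' : C5.SmallLevel C.S.K₀⦄ (f : K' ⟶ K), Injective (rationalTateModuleMap ℓ (C.Atr f)).dualMap :=
    fun _ _ f => B.dualMap_rationalTateModuleMap_Atr_injective ℓ c f
  have h1 : c.cmp (C.A K) y = 0 :=
    toTower_baseChange_injective C ℓ (C.toTower_injective ℓ hI K) (by rw [hx, map_zero])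
  have h2 : y = 0 := (injective_iff_map_eq_zero (c.cmp (C.A K))).1 (c.bijective (C.A K)).1 y h1
  rw [h2, map_zero]

/-- The comparison is surjective (every class of `ℚ_ℓ^{ac} ⊗ H¹_ét(A_∞)` is a level class, and `c_{A_K}` is onto).
[cite: Liu2021, §4.3 (FJcycle.tex l. 2154–2158)] -/
theorem cmpAlong_surjective : Surjective (B.cmpAlong ℓ ι c) := by
  intro v
  obtain ⟨K, -, w, rfl⟩ := exists_eq_toTower_baseChange C ℓ ⟨C.S.K₀, le_rfl⟩ v
  obtain ⟨y, rfl⟩ := (c.bijective (C.A K)).2 w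
  exact ⟨B.b K y, B.cmpAlong_b ℓ ι c K y⟩

/-- The comparison is a bijection. [cite: Liu2021, §4.3 (FJcycle.tex l. 2154)] -/
theorem cmpAlong_bijective : Bijective (B.cmpAlong ℓ ι c) :=
  ⟨B.cmpAlong_injective ℓ ι c, B.cmpAlong_surjective ℓ ι c⟩

/-- **Hecke equivariance**: for every étale Hecke datum `X` INDUCED by the translates `T`, `cmp ∘ rhoB g = (X.rhoEt g ⊗ 1) ∘ cmp`
(`b_hecke`: `rhoB g` is `Alb(T_g)^*` on the levels; naturality of `c`; `IsInducedBy`). [cite: Liu2021, §4.3 (FJcycle.tex l. 2160) and Thm. 4.18 proof l. 2254–2257] -/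
theorem cmpAlong_rhoB {X : C.EtaleHeckeDatum ℓ} (hX : X.IsInducedBy T) (g : C.G) (x : H) :
    B.cmpAlong ℓ ι c (rhoB g x) = (X.rhoEt g).baseChange (AlgebraicClosure ℚ_[ℓ]) (B.cmpAlong ℓ ι c x) := by
  obtain ⟨K', y, rfl⟩ := B.exhaust x
  rw [B.b_hecke g (C5.heckeLevel g K') K' (C5.heckeLE_heckeLevel g K') y, cmpAlong_b, cmpAlong_b, c.natural]
  exact (LinearMap.congr_fun (rhoEt_baseChange_comp_toTower hX g (C5.heckeLevel g K') K' (C5.heckeLE_heckeLevel g K'))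
    (c.cmp (C.A K') y)).symm

/-- **The Betti comparison structure of `EtaleH1Tower.lean`, INHABITED** for the pinned tower `(H, rhoB)` and any étale Hecke datum
induced by `T`. [cite: Liu2021, §4.3 (FJcycle.tex l. 2154–2160)] -/
def bettiComparisonAlong {X : C.EtaleHeckeDatum ℓ} (hX : X.IsInducedBy T) : C.BettiComparison ℓ X H rhoB ι where
  cmp := B.cmpAlong ℓ ι c
  bijective := B.cmpAlong_bijective ℓ ι c
  comm g x := B.cmpAlong_rhoB ℓ ι c hX g x

/-- The comparison of `bettiComparisonAlong` is `cmpAlong` (by `rfl`). [cite: Liu2021, §4.3 (FJcycle.tex l. 2154)] -/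
theorem bettiComparisonAlong_cmp {X : C.EtaleHeckeDatum ℓ} (hX : X.IsInducedBy T) :
    (B.bettiComparisonAlong ℓ ι c hX).cmp = B.cmpAlong ℓ ι c :=
  rfl

end Sec42Data.BettiPinning

/-! ## §4 The named fact holds, granted descent up to isogeny -/

namespace Sec42Data

variable (C : Sec42Data P5 isotropicAt) (ℓ : ℕ) [Fact ℓ.Prime]

/-- **[Liu2021, §4.3 l. 2154–2160] «`StubEtaleModel`» HOLDS from (D)**: for EVERY §4.2 datum `C`, translates `T` with
`T.IsogenyDescent`, embedding `τ'`, `ι : ℂ ≃ ℚ_ℓ^{ac}` and Betti tower `(H, rhoB)` pinned by `B`, the named fact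
`C.exists_etaleHeckeDatum_with_bettiComparison ℓ T τ' ι H rhoB B` (p595473) is a THEOREM: `X := T.etaleHeckeDatumOfTranslates`
(induced by `T`, level-compatible at every level), `cmp := B.cmpAlong` over the comparison family `c := h1ComparisonFamilyAlong τ' ℓ ι`
([SGA4 XI 4.4], `H1ComparisonFamilyHolds.lean`), and `cmp (b_K y) = ([·]_K ⊗ 1)(c_{A_K} y)` by construction.
[cite: Liu2021, §4.3 (FJcycle.tex l. 2154–2160); §4.2 l. 2074, 2079–2081; Thm. 4.18 (1) l. 2239] [cite: SGA4Tome3, Exp. XI Thm. 4.4]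
[cite: Lang1982AbelianFunctions, Ch. VII §2, p. 115] -/
theorem exists_etaleHeckeDatum_with_bettiComparison_of_isogenyDescent {T : C.HeckeTranslates} (hD : T.IsogenyDescent)
    (τ' : E →+* ℂ) (ι : ℂ ≃+* AlgebraicClosure ℚ_[ℓ]) (H : Type) [AddCommGroup H] [Module ℂ H] (rhoB : Representation ℂ C.G H)
    (B : C.BettiPinning T τ' H rhoB) : C.exists_etaleHeckeDatum_with_bettiComparison ℓ T τ' ι H rhoB B := by
  have hI : ∀ ⦃K K' : C5.SmallLevel C.S.K₀⦄ (f : K' ⟶ K), Injective (rationalTateModuleMap ℓ (C.Atr f)).dualMap :=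
    fun _ _ f => B.dualMap_rationalTateModuleMap_Atr_injective ℓ (h1ComparisonFamilyAlong τ' ℓ ι) f
  exact ⟨T.etaleHeckeDatumOfTranslates ℓ hI hD,
    B.bettiComparisonAlong ℓ ι (h1ComparisonFamilyAlong τ' ℓ ι) (T.isInducedBy_etaleHeckeDatumOfTranslates ℓ hI hD),
    h1ComparisonFamilyAlong τ' ℓ ι, T.isInducedBy_etaleHeckeDatumOfTranslates ℓ hI hD,
    fun K y => B.cmpAlong_b ℓ ι (h1ComparisonFamilyAlong τ' ℓ ι) K y⟩

/-- **The same with a PRESCRIBED comparison family `c`** (any natural bijective degree-one comparison along `(τ', ι)` may be used as the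
levelwise comparison of the fact). [cite: Liu2021, §4.3 (FJcycle.tex l. 2154–2160)] [cite: SGA4Tome3, Exp. XI Thm. 4.4] -/
theorem exists_etaleHeckeDatum_with_bettiComparison_of_isogenyDescent_of_family {T : C.HeckeTranslates} (hD : T.IsogenyDescent)
    (τ' : E →+* ℂ) (ι : ℂ ≃+* AlgebraicClosure ℚ_[ℓ]) (c : H1ComparisonFamily (E := E) τ' ℓ ι)
    (H : Type) [AddCommGroup H] [Module ℂ H] (rhoB : Representation ℂ C.G H) (B : C.BettiPinning T τ' H rhoB) :
    ∃ (X : C.EtaleHeckeDatum ℓ) (cmp : C.BettiComparison ℓ X H rhoB ι),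
      X.IsInducedBy T ∧ X.rhoEt = T.etHeckeRep ℓ ∧
        ∀ (K : C5.SmallLevel C.S.K₀) (y : C.bettiH1 τ' K),
          cmp.cmp (B.b K y) = (C.toTower ℓ K).baseChange (AlgebraicClosure ℚ_[ℓ]) (c.cmp (C.A K) y) := by
  have hI : ∀ ⦃K K' : C5.SmallLevel C.S.K₀⦄ (f : K' ⟶ K), Injective (rationalTateModuleMap ℓ (C.Atr f)).dualMap :=
    fun _ _ f => B.dualMap_rationalTateModuleMap_Atr_injective ℓ c f
  exact ⟨T.etaleHeckeDatumOfTranslates ℓ hI hD,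
    B.bettiComparisonAlong ℓ ι c (T.isInducedBy_etaleHeckeDatumOfTranslates ℓ hI hD),
    T.isInducedBy_etaleHeckeDatumOfTranslates ℓ hI hD, rfl, fun K y => B.cmpAlong_b ℓ ι c K y⟩

/-- **Level compatibility of the pinned étale tower, from the pinning and (D)**: `[·]_K : H¹_ét(A_K) → H¹_ét(A_∞)` is injective with image
the `K`-invariants of the induced Hecke action, at EVERY sufficiently small level `K` (the étale form of [Liu2021, Thm. 4.18 (1)]'s
«`Ω(μ)^K`» bookkeeping, with row (I) replaced by the Betti pinning). [cite: Liu2021, Thm. 4.18 (1) (FJcycle.tex l. 2239) and §4.3 l. 2158–2160] -/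
theorem toTower_injective_and_range_eq_of_bettiPinning {T : C.HeckeTranslates} (hD : T.IsogenyDescent)
    {τ' : E →+* ℂ} {ι : ℂ ≃+* AlgebraicClosure ℚ_[ℓ]} (c : H1ComparisonFamily (E := E) τ' ℓ ι)
    {H : Type} [AddCommGroup H] [Module ℂ H] {rhoB : Representation ℂ C.G H} (B : C.BettiPinning T τ' H rhoB)
    (K : C5.SmallLevel C.S.K₀) :
    Injective (C.toTower ℓ K) ∧ Set.range (C.toTower ℓ K) = {x | ∀ k ∈ K.1.1, T.etHeckeRep ℓ k x = x} :=
  have hI : ∀ ⦃K K' : C5.SmallLevel C.S.K₀⦄ (f : K' ⟶ K), Injective (rationalTateModuleMap ℓ (C.Atr f)).dualMap :=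
    fun _ _ f => B.dualMap_rationalTateModuleMap_Atr_injective ℓ c f
  ⟨C.toTower_injective ℓ hI K, T.range_toTower_eq_of_isogenyDescent ℓ hI hD K⟩

end Sec42Data

end Literature.NumberTheory.Automorphic.Liu2021.AppendixC

end
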